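import Summits.BirchSwinnertonDyer.BirchSwinnertonDyer.Theorems.PrintCf2SplitBadTwoUnrLocalLift
import Summits.BirchSwinnertonDyer.BirchSwinnertonDyer.Theorems.PrintCf2SplitBadTwoLineLocalGroupAtRamified
import Literature.NumberTheory.EllipticCurves.H1TrivialAction
import Literature.NumberTheory.GaloisRepresentations.HOneRestrictionOntoInvariantsFinite
import Literature.NumberTheory.GaloisRepresentations.DecompositionGroupRelSlim
import Literature.GroupTheory.FreeProcyclicQuotientRetraction
import Literature.AnabelianGeometry.AbsoluteAnabelian.FreeProcyclicHOneTorsion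
import HarnessLib

/-!
# Crux `PrintCf2.SplitBadTwoRankOneOfFacts` (stmt-BirchSwinnertonDyer-20368), skeleton v13.1, stub S3d `stub_strictDefectAtVbar_two`, class (iii) — file D1
# (generic): the LOCAL DEFECT GROUP `𝓛 = ker(H¹(D″, M) → H¹(ker κ ∩ I_𝔮, M))` WHEN `D″ = ker κ ∩ D_𝔮` ACTS TRIVIALLY: evaluation at ONE degree-one
# element `φ₀ ∈ D″` is a `D_𝔮`-equivariant bijection `𝓛 → M`

Cell `bsd-print-cf2`, width seat `bsd-line-cf2-p1-w6` g5 (S3d: «𝓗 local + ch(𝓗^∨)(0) per class»); `--supports stmt-BirchSwinnertonDyer-20368 --as helper`.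
HONEST FRAMING: nothing here closes the crux or a registered stub; no summit statement is proved by this seat; BSD is not proved by any of this.
No definition, no named fact, no `sorry`. GENERIC: any number field `K`, prime `p`, `ℤ_p`-line `κ`, place `𝔮`, discrete torsion `Γ_K`-module `M`.
CURRENCY (-w4 g11's h𝓛 in `…UnrBaseLift.natCard_endCoinvariants_conjUnr_eq_one_of_frame`): `D″ := Coinv.kerD κ 𝔮 ≤ ↥(decomp 𝔮)`,
`ρ := resH1Hom (Coinv.toKerD κ 𝔮 (kerSubgroup_inf_inertia_le_decomp κ 𝔮) inf_le_left) (AddMonoidHom.id M) _`, `𝓛 := {a | ρ a = 0}`.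
HYPOTHESES: `htriv : ∀ (n : ↥D″) (m : M), n • m = m` (S3d class (iii): `…RestrictedSelmerPair.smul_eq_self_of_mem_decomp_vbar_inf_kerSubgroup_of_frame_classThree`)
and a degree-one `σ₀ ∈ Γ_{K_𝔮}` (`IsFrobPow σ₀ 1`) with `res σ₀ = φ₀ ∈ D″` (on the frames `ε(res σ₀) = α`, file D2).
* `resH1Hom_toKerD_eq_zero_iff` — `H¹(D″, M) = Hom_cont(D″, M)` (Literature `H1TrivialAction`), and `a ∈ 𝓛 ↔` its cocycle kills `ker κ ∩ I_𝔮`.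
* `subgroup_eq_top_of_isOpen_of_dense_zpowers`, **`eq_top_of_isOpen_of_toKerD_mem`** — `D″` is TOPOLOGICALLY GENERATED by `ker κ ∩ I_𝔮` and `φ₀`
  (in `Γ_{K_𝔮}`: the image of a compact subgroup in `Γ_{K_𝔮} ⧸ I` is closed and contains the dense `⟨σ̄₀⟩`, `dense_zpowers_mk_absInertia_of_isFrobPow`).
* **`eq_zero_of_evalH1_eq_zero`** — INJECTIVITY of `eval_{φ₀}` on `𝓛` (the zero set of the cocycle is an open subgroup containing the generators).
* **`exists_evalH1_eq`** — SURJECTIVITY: `cl⟨σ₀⟩ ≤ Γ_{K_𝔮}` is free procyclic, Literature `evalMod_surjective_of_isTorsion` ("`H¹(Ẑ, M) = M/(F − 1)M`", here `F = 1`)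
  gives a continuous homomorphism `cl⟨σ₀⟩ → M` with prescribed value at `σ₀`; compose with the retraction `Γ_{K_𝔮} → cl⟨σ₀⟩` (kernel `I`,
  `exists_continuousMonoidHom_retraction_of_isFreeProcyclic`) and the topological isomorphism `res⁻¹(ker κ) ⥲ D″` (`absGaloisRestrict_adicCompletion_injective`).
* **`resH1Hom_toKerD_conjH1_eq_zero`**, **`evalH1_conjH1_eq_smul`** — `𝓛` is `D_𝔮`-stable and `eval_{φ₀}(conj_δ a) = δ • eval_{φ₀}(a)` (`δ ∈ D_𝔮`; the
  commutator `[φ₀⁻¹, δ⁻¹]` lies in `ker κ ∩ I_𝔮` since `Γ_{K_𝔮} ⧸ I` is abelian, `commutator_mem_galUnr`).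
So `𝓛 ≅ M` with `D_𝔮` acting through `M`; on S3d's class (iii) (`M = W*`) h𝓛, `#𝓛^{δ} = #(W*)^{δ}` and the Prüfer property follow (file D2 / -w3 g12 / -w4 g11).
presearch: Greenberg–Vatsal 2000 §2 pp. 17–21 (local term `Hom(Gal(K^{nr}_{∞,η}/K_{∞,η}), A)` of the non-primitive Selmer group); Greenberg LNM 1716 §3 Lemma 3.3;
Serre, Local Fields XIII §1 Prop. 1 — held; tree assembly, no new fact. beyond-print theorem: no.

References: [GreenbergVatsal2000] §2 pp. 17–21; [GreenbergLNM1716] §3 Lemma 3.3; [SerreLocalFields1979] XIII §1 Prop. 1; [NeukirchSchmidtWingberg2008]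
(1.6.3), Thm. 7.5.3; [SerreGaloisCohomology1997] I §2.3–2.5; [RibesZalesskii2010] §2.5.
-/

noncomputable section

open scoped Classical

set_option linter.dupNamespace false
set_option autoImplicit false

open NumberField IsDedekindDomain Field
open Literature.NumberTheory.EllipticCurves Literature.NumberTheory.EllipticCurves.GreenbergSelmer
open Literature.NumberTheory.GaloisRepresentations
open Summit.BirchSwinnertonDyer.Rank1Residual.X11b
open Summit.BirchSwinnertonDyer.BirchSwinnertonDyer.Theorems.PrintCf2.UnrBaseLift

namespace Summit.BirchSwinnertonDyer.BirchSwinnertonDyer.Theorems.PrintCf2.LocalDefectTrivial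

variable {K : Type} [Field K] [NumberField K] {p : ℕ} [Fact p.Prime] (κ : ZpExtension K p) (𝔮 : HeightOneSpectrum (𝓞 K))
  {M : Type} [AddCommGroup M] [DistribMulAction (absoluteGaloisGroup K) M] [TopologicalSpace M] [DiscreteTopology M]

/-! ## §1. `𝓛` on cocycles: with `D″` acting trivially, `a ∈ 𝓛 ↔` the cocycle of `a` kills `ker κ ∩ I_𝔮` -/

omit [TopologicalSpace M] [DiscreteTopology M] in
/-- The subgroup `ker κ ⊓ I_𝔮 ≤ Γ_K` acts trivially on `M` when `D″ = ker κ ∩ D_𝔮` does. [folklore] -/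
theorem smul_eq_self_of_mem_kerSubgroup_inf_inertia (htriv : ∀ (n : ↥(Coinv.kerD κ 𝔮)) (m : M), n • m = m)
    (i : ↥(κ.kerSubgroup ⊓ inertia 𝔮)) (m : M) : i • m = m :=
  htriv (Coinv.toKerD κ 𝔮 (kerSubgroup_inf_inertia_le_decomp κ 𝔮) inf_le_left i) m

/-- **`a ∈ 𝓛` iff the cocycle of `a` vanishes on `ker κ ∩ I_𝔮`** (`D″` acting trivially, so `H¹(D″, M) = Hom_cont(D″, M)` with one cocycle per class,
and the same for the subgroup `ker κ ⊓ I_𝔮`). [cite: SerreGaloisCohomology1997, I §2.3] [cite: GreenbergVatsal2000, §2 p. 17] -/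
theorem resH1Hom_toKerD_eq_zero_iff (htriv : ∀ (n : ↥(Coinv.kerD κ 𝔮)) (m : M), n • m = m) (a : subgroupH1 (Coinv.kerD κ 𝔮) M) :
    resH1Hom (Coinv.toKerD κ 𝔮 (kerSubgroup_inf_inertia_le_decomp κ 𝔮) (inf_le_left : κ.kerSubgroup ⊓ inertia 𝔮 ≤ κ.kerSubgroup))
        (AddMonoidHom.id M) (fun _ _ ↦ rfl) a = 0 ↔
      ∀ i : ↥(κ.kerSubgroup ⊓ inertia 𝔮),
        (cocycleOf _ M htriv a).1 (Coinv.toKerD κ 𝔮 (kerSubgroup_inf_inertia_le_decomp κ 𝔮) inf_le_left i) = 0 := by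
  have htrivI : ∀ (i : ↥(κ.kerSubgroup ⊓ inertia 𝔮)) (m : M), i • m = m := smul_eq_self_of_mem_kerSubgroup_inf_inertia κ 𝔮 htriv
  conv_lhs => rw [← oneCocycleClass_cocycleOf htriv a, LocBridge.resH1Hom_oneCocycleClass', oneCocycleClass_eq_zero_iff_of_trivial htrivI]
  constructor
  · intro h i
    exact congrArg (fun f : contOneCocycles (discreteTopRep ↥(κ.kerSubgroup ⊓ inertia 𝔮) M) ↦ f.1 i) h
  · intro h
    apply Subtype.ext
    ext i
    exact h i

/-! ## §2. Topological generation of `D″` by `ker κ ∩ I_𝔮` and one degree-one element -/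

/-- **Generation lemma** (topological groups): `G` compact, `N ⊴ G` closed, `H ≤ G` closed, `σ₀ ∈ H` with `⟨σ̄₀⟩` dense in `G ⧸ N`; then an open subgroup
of `H` containing `N ∩ H` and `σ₀` is all of `H` (its image in `G ⧸ N` is compact, hence closed, and contains the dense `⟨σ̄₀⟩`).
[cite: NeukirchSchmidtWingberg2008, Thm. 7.5.3] [cite: RibesZalesskii2010, §2.5] -/
theorem subgroup_eq_top_of_isOpen_of_dense_zpowers {G : Type*} [Group G] [TopologicalSpace G] [IsTopologicalGroup G] [CompactSpace G]
    (N : Subgroup G) [N.Normal] [IsClosed (N : Set G)] (H : Subgroup G) (hH : IsClosed (H : Set G)) {σ₀ : G} (hσ₀H : σ₀ ∈ H)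
    (hd : Dense (Subgroup.zpowers (QuotientGroup.mk σ₀ : G ⧸ N) : Set (G ⧸ N)))
    (U : Subgroup ↥H) (hU : IsOpen (U : Set ↥H)) (hNU : ∀ g : ↥H, (g : G) ∈ N → g ∈ U) (hσU : (⟨σ₀, hσ₀H⟩ : ↥H) ∈ U) :
    U = ⊤ := by
  haveI : CompactSpace ↥H := isCompact_iff_compactSpace.mp hH.isCompact
  have hUc : IsCompact (U : Set ↥H) := (Subgroup.isClosed_of_isOpen U hU).isCompact
  have hSc := (hUc.image (QuotientGroup.continuous_mk.comp continuous_subtype_val) (f := fun u : ↥H ↦ (QuotientGroup.mk (u : G) : G ⧸ N))).isClosed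
  have hzp : (Subgroup.zpowers (QuotientGroup.mk σ₀ : G ⧸ N) : Set (G ⧸ N)) ⊆
      (fun u : ↥H ↦ (QuotientGroup.mk (u : G) : G ⧸ N)) '' (U : Set ↥H) := by
    intro q hq
    obtain ⟨k, rfl⟩ := Subgroup.mem_zpowers_iff.mp hq
    refine ⟨⟨σ₀, hσ₀H⟩ ^ k, U.zpow_mem hσU k, ?_⟩
    change (QuotientGroup.mk (((⟨σ₀, hσ₀H⟩ ^ k : ↥H) : G)) : G ⧸ N) = (QuotientGroup.mk σ₀ : G ⧸ N) ^ k
    rw [SubgroupClass.coe_zpow, QuotientGroup.mk_zpow]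
  have huniv : (fun u : ↥H ↦ (QuotientGroup.mk (u : G) : G ⧸ N)) '' (U : Set ↥H) = Set.univ := by
    have h1 := hSc.closure_subset_iff.mpr hzp
    rw [hd.closure_eq] at h1
    exact Set.eq_univ_of_univ_subset h1
  refine eq_top_iff.mpr fun x _ ↦ ?_
  have hx : (QuotientGroup.mk (x : G) : G ⧸ N) ∈ (fun u : ↥H ↦ (QuotientGroup.mk (u : G) : G ⧸ N)) '' (U : Set ↥H) := by
    rw [huniv]; exact Set.mem_univ _
  obtain ⟨u, hu, hux⟩ := hx
  have h2 := U.mul_mem hu (hNU (u⁻¹ * x) (QuotientGroup.eq.mp hux))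
  rwa [mul_inv_cancel_left] at h2

/-- **`D″ = ker κ ∩ D_𝔮` is topologically generated by `ker κ ∩ I_𝔮` and `φ₀ = res σ₀`** (`IsFrobPow σ₀ 1`): every open subgroup of `D″` containing both
is `⊤` (the generation lemma for `H_F = res⁻¹(ker κ) ≤ Γ_{K_𝔮}`, `N = I`, `⟨σ̄₀⟩` dense by `dense_zpowers_mk_absInertia_of_isFrobPow`, transported along
`H_F ↠ D″`). [cite: NeukirchSchmidtWingberg2008, Thm. 7.5.3] [cite: NeukirchANT1999, Ch. II §9 (9.9)] -/
theorem eq_top_of_isOpen_of_toKerD_mem {σ₀ : absoluteGaloisGroup (𝔮.adicCompletion K)} (hσ₀ : IsFrobPow σ₀ 1)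
    {φ₀ : ↥(Coinv.kerD κ 𝔮)} (hφ₀ : ((φ₀ : ↥(decomp 𝔮)) : absoluteGaloisGroup K) = absGaloisRestrict K (𝔮.adicCompletion K) σ₀)
    (U : Subgroup ↥(Coinv.kerD κ 𝔮)) (hU : IsOpen (U : Set ↥(Coinv.kerD κ 𝔮)))
    (hIU : ∀ i : ↥(κ.kerSubgroup ⊓ inertia 𝔮), Coinv.toKerD κ 𝔮 (kerSubgroup_inf_inertia_le_decomp κ 𝔮) inf_le_left i ∈ U)
    (hφU : φ₀ ∈ U) : U = ⊤ := by
  haveI : CompactSpace (absoluteGaloisGroup (𝔮.adicCompletion K)) := absoluteGaloisGroup_compactSpace _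
  haveI : (absInertia (𝔮.adicCompletion K)).Normal := absInertia_normal_holds _
  haveI : IsClosed ((absInertia (𝔮.adicCompletion K) : Subgroup (absoluteGaloisGroup (𝔮.adicCompletion K))) :
      Set (absoluteGaloisGroup (𝔮.adicCompletion K))) := isClosed_absInertia_holds _
  have hσ₀κ : absGaloisRestrict K (𝔮.adicCompletion K) σ₀ ∈ κ.kerSubgroup := by
    have h := (Coinv.mem_kerD_iff κ 𝔮 _).mp φ₀.2
    rwa [hφ₀] at h
  -- the closed subgroup `H_F = res⁻¹(ker κ)` and its continuous surjection onto `D″`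
  have hHFc : IsClosed ((κ.kerSubgroup.comap (absGaloisRestrict K (𝔮.adicCompletion K)).toMonoidHom :
      Subgroup (absoluteGaloisGroup (𝔮.adicCompletion K))) : Set (absoluteGaloisGroup (𝔮.adicCompletion K))) :=
    κ.isClosed_kerSubgroup.preimage (absGaloisRestrict K (𝔮.adicCompletion K)).continuous
  let f : ↥(κ.kerSubgroup.comap (absGaloisRestrict K (𝔮.adicCompletion K)).toMonoidHom) →* ↥(Coinv.kerD κ 𝔮) :=
    { toFun := fun g ↦ ⟨⟨absGaloisRestrict K (𝔮.adicCompletion K) (g : absoluteGaloisGroup (𝔮.adicCompletion K)),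
        (mem_decomp_iff 𝔮 _).mpr ⟨(g : absoluteGaloisGroup (𝔮.adicCompletion K)), rfl⟩⟩, (Coinv.mem_kerD_iff κ 𝔮 _).mpr g.2⟩
      map_one' := Subtype.ext (Subtype.ext (map_one (absGaloisRestrict K (𝔮.adicCompletion K))))
      map_mul' := fun a b ↦ Subtype.ext (Subtype.ext (map_mul (absGaloisRestrict K (𝔮.adicCompletion K))
        (a : absoluteGaloisGroup (𝔮.adicCompletion K)) (b : absoluteGaloisGroup (𝔮.adicCompletion K)))) }
  have hfc : Continuous f :=
    (((absGaloisRestrict K (𝔮.adicCompletion K)).continuous.comp continuous_subtype_val).subtype_mk _).subtype_mk _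
  have hσ₀HF : σ₀ ∈ κ.kerSubgroup.comap (absGaloisRestrict K (𝔮.adicCompletion K)).toMonoidHom := hσ₀κ
  -- pull back `U` and apply the generation lemma
  have htop := subgroup_eq_top_of_isOpen_of_dense_zpowers (absInertia (𝔮.adicCompletion K)) _ hHFc hσ₀HF
    (dense_zpowers_mk_absInertia_of_isFrobPow _ hσ₀) (U.comap f) (hU.preimage hfc)
    (fun g hg ↦ by
      have hmem : absGaloisRestrict K (𝔮.adicCompletion K) (g : absoluteGaloisGroup (𝔮.adicCompletion K)) ∈ κ.kerSubgroup ⊓ inertia 𝔮 :=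
        Subgroup.mem_inf.mpr ⟨g.2, Subgroup.mem_map.mpr ⟨(g : absoluteGaloisGroup (𝔮.adicCompletion K)), hg, rfl⟩⟩
      have hfg : f g = Coinv.toKerD κ 𝔮 (kerSubgroup_inf_inertia_le_decomp κ 𝔮) inf_le_left ⟨_, hmem⟩ :=
        Subtype.ext (Subtype.ext rfl)
      change f g ∈ U
      rw [hfg]; exact hIU _)
    (by
      have hf₀ : f ⟨σ₀, hσ₀HF⟩ = φ₀ := Subtype.ext (Subtype.ext hφ₀.symm)
      change f ⟨σ₀, hσ₀HF⟩ ∈ U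
      rw [hf₀]; exact hφU)
  -- conclude in `D″`
  rw [eq_top_iff]
  rintro ⟨⟨g, hgD⟩, hgκ⟩ -
  obtain ⟨σ, hσ⟩ := (mem_decomp_iff 𝔮 g).mp hgD
  have hσHF : σ ∈ κ.kerSubgroup.comap (absGaloisRestrict K (𝔮.adicCompletion K)).toMonoidHom := by
    change absGaloisRestrict K (𝔮.adicCompletion K) σ ∈ κ.kerSubgroup
    rw [hσ]; exact (Coinv.mem_kerD_iff κ 𝔮 _).mp hgκ
  have hσU : (⟨σ, hσHF⟩ : ↥(κ.kerSubgroup.comap (absGaloisRestrict K (𝔮.adicCompletion K)).toMonoidHom)) ∈ U.comap f :=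
    htop ▸ Subgroup.mem_top _
  have hfσ : f ⟨σ, hσHF⟩ = ⟨⟨g, hgD⟩, hgκ⟩ := Subtype.ext (Subtype.ext hσ)
  have h := Subgroup.mem_comap.mp hσU
  rwa [hfσ] at h

/-! ## §3. Injectivity of evaluation at `φ₀` on `𝓛` -/

/-- **A class of `𝓛` vanishing at `φ₀` is zero** (`D″` acting trivially): its cocycle is a continuous homomorphism `D″ → M` whose zero set is an open
subgroup containing `ker κ ∩ I_𝔮` and `φ₀`, hence all of `D″` (§2). [cite: SerreGaloisCohomology1997, I §2.3] [cite: GreenbergVatsal2000, §2 p. 17] -/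
theorem eq_zero_of_evalH1_eq_zero (htriv : ∀ (n : ↥(Coinv.kerD κ 𝔮)) (m : M), n • m = m)
    {σ₀ : absoluteGaloisGroup (𝔮.adicCompletion K)} (hσ₀ : IsFrobPow σ₀ 1)
    {φ₀ : ↥(Coinv.kerD κ 𝔮)} (hφ₀ : ((φ₀ : ↥(decomp 𝔮)) : absoluteGaloisGroup K) = absGaloisRestrict K (𝔮.adicCompletion K) σ₀)
    {a : subgroupH1 (Coinv.kerD κ 𝔮) M}
    (ha : resH1Hom (Coinv.toKerD κ 𝔮 (kerSubgroup_inf_inertia_le_decomp κ 𝔮) (inf_le_left : κ.kerSubgroup ⊓ inertia 𝔮 ≤ κ.kerSubgroup))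
        (AddMonoidHom.id M) (fun _ _ ↦ rfl) a = 0)
    (h0 : evalH1 htriv φ₀ a = 0) : a = 0 := by
  set f := cocycleOf _ M htriv a with hf
  have hmul := cocycle_map_mul_of_trivial htriv f
  -- the zero set of `f` as an open subgroup
  let U : Subgroup ↥(Coinv.kerD κ 𝔮) :=
    { carrier := {n | f.1 n = 0}
      one_mem' := map_one_eq_zero_of_map_mul hmul
      mul_mem' := fun {a b} ha hb ↦ by change f.1 (a * b) = 0; rw [hmul, ha, hb, add_zero]
      inv_mem' := fun {a} ha ↦ by change f.1 a⁻¹ = 0; rw [cocycle_map_inv_of_trivial htriv, ha, neg_zero] }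
  have hU : IsOpen (U : Set ↥(Coinv.kerD κ 𝔮)) := isOpen_ker_of_continuous f.1.continuous
  have hIU := (resH1Hom_toKerD_eq_zero_iff κ 𝔮 htriv a).mp ha
  have htop := eq_top_of_isOpen_of_toKerD_mem κ 𝔮 hσ₀ hφ₀ U hU (fun i ↦ hIU i) h0
  have hf0 : f = 0 := Subtype.ext (ContinuousMap.ext fun n ↦ (htop ▸ Subgroup.mem_top n : n ∈ U))
  rw [← oneCocycleClass_cocycleOf htriv a, ← hf, hf0, oneCocycleClass_zero]

/-! ## §4. Surjectivity of evaluation at `φ₀` on `𝓛` -/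

/-- **Every `m ∈ M` is the value at `φ₀` of a class of `𝓛`** (`D″` acting trivially, `M` torsion): `cl⟨σ₀⟩ ≤ Γ_{K_𝔮}` is free procyclic, so
`H¹(cl⟨σ₀⟩, M) → M`, `[z] ↦ z(σ₀)`, is onto for the TRIVIAL action (`evalMod_surjective_of_isTorsion`); `z ∘ r ∘ res⁻¹` (`r` the retraction `Γ_{K_𝔮} → cl⟨σ₀⟩`
with kernel `I`, `res : res⁻¹(ker κ) ⥲ D″` a topological isomorphism) is a continuous homomorphism `D″ → M` killing `ker κ ∩ I_𝔮` with value `m` at `φ₀`.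
[cite: SerreLocalFields1979, XIII §1 Prop. 1] [cite: NeukirchSchmidtWingberg2008, Thm. 7.5.3] [cite: GreenbergVatsal2000, §2 p. 17] -/
theorem exists_evalH1_eq (htriv : ∀ (n : ↥(Coinv.kerD κ 𝔮)) (m : M), n • m = m) (htor : AddMonoid.IsTorsion M)
    {σ₀ : absoluteGaloisGroup (𝔮.adicCompletion K)} (hσ₀ : IsFrobPow σ₀ 1)
    {φ₀ : ↥(Coinv.kerD κ 𝔮)} (hφ₀ : ((φ₀ : ↥(decomp 𝔮)) : absoluteGaloisGroup K) = absGaloisRestrict K (𝔮.adicCompletion K) σ₀) (m : M) :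
    ∃ a : subgroupH1 (Coinv.kerD κ 𝔮) M,
      resH1Hom (Coinv.toKerD κ 𝔮 (kerSubgroup_inf_inertia_le_decomp κ 𝔮) (inf_le_left : κ.kerSubgroup ⊓ inertia 𝔮 ≤ κ.kerSubgroup))
          (AddMonoidHom.id M) (fun _ _ ↦ rfl) a = 0 ∧
      evalH1 htriv φ₀ a = m := by
  haveI : CompactSpace (absoluteGaloisGroup (𝔮.adicCompletion K)) := absoluteGaloisGroup_compactSpace _
  haveI : (absInertia (𝔮.adicCompletion K)).Normal := absInertia_normal_holds _
  have hIc : IsClosed ((absInertia (𝔮.adicCompletion K) : Subgroup (absoluteGaloisGroup (𝔮.adicCompletion K))) :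
      Set (absoluteGaloisGroup (𝔮.adicCompletion K))) := isClosed_absInertia_holds _
  have hfree := isFreeProcyclic_quotient_absInertia' (𝔮.adicCompletion K)
  have hd := dense_zpowers_mk_absInertia_of_isFrobPow _ hσ₀
  -- the free procyclic closed subgroup `C = cl⟨σ₀⟩ ≤ Γ_{K_𝔮}` and a continuous homomorphism `z : C → M` with `z(σ₀) = m`
  have hCc : IsClosed (((Subgroup.zpowers σ₀).topologicalClosure : Subgroup (absoluteGaloisGroup (𝔮.adicCompletion K))) :
      Set (absoluteGaloisGroup (𝔮.adicCompletion K))) := Subgroup.isClosed_topologicalClosure _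
  haveI : CompactSpace ↥((Subgroup.zpowers σ₀).topologicalClosure) := isCompact_iff_compactSpace.mp hCc.isCompact
  have hidx := Literature.GroupTheory.exists_isOpen_index_topologicalClosure_zpowers (absInertia (𝔮.adicCompletion K)) hIc hfree σ₀ hd
  obtain ⟨c, hc⟩ := Literature.AnabelianGeometry.AbsoluteAnabelian.evalMod_surjective_of_isTorsion
    (Literature.GroupTheory.dense_zpowers_mk_topologicalClosure' σ₀) hidx htor
    (ContinuousRep.trivial ↥((Subgroup.zpowers σ₀).topologicalClosure) ℤ M) (QuotientAddGroup.mk m)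
  obtain ⟨z, rfl⟩ := oneCocycleClass_surjective _ c
  rw [Literature.AnabelianGeometry.AbsoluteAnabelian.evalMod_oneCocycleClass, QuotientAddGroup.eq,
    Literature.AnabelianGeometry.AbsoluteAnabelian.mem_subOneRange_iff] at hc
  obtain ⟨v, hv⟩ := hc
  have hzσ : z.1 ⟨σ₀, Subgroup.le_topologicalClosure _ (Subgroup.mem_zpowers σ₀)⟩ = m := by
    have h0 : ContinuousRep.trivial ↥((Subgroup.zpowers σ₀).topologicalClosure) ℤ M
        ⟨σ₀, Subgroup.le_topologicalClosure _ (Subgroup.mem_zpowers σ₀)⟩ v = v := rfl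
    rw [h0, sub_self] at hv
    exact (neg_add_eq_zero.mp hv.symm)
  have hzmul : ∀ a b : ↥((Subgroup.zpowers σ₀).topologicalClosure), z.1 (a * b) = z.1 a + z.1 b := fun a b ↦
    (mem_contOneCocycles_iff z.1).mp z.2 a b
  -- the retraction `r : Γ_{K_𝔮} → cl⟨σ₀⟩` with kernel `I`
  obtain ⟨r, hrC, hrid, hrker⟩ := Literature.GroupTheory.exists_continuousMonoidHom_retraction_of_isFreeProcyclic
    (absInertia (𝔮.adicCompletion K)) hIc hfree σ₀ hd
  -- the topological isomorphism `H_F = res⁻¹(ker κ) ⥲ D″`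
  have hHFc : IsClosed ((κ.kerSubgroup.comap (absGaloisRestrict K (𝔮.adicCompletion K)).toMonoidHom :
      Subgroup (absoluteGaloisGroup (𝔮.adicCompletion K))) : Set (absoluteGaloisGroup (𝔮.adicCompletion K))) :=
    κ.isClosed_kerSubgroup.preimage (absGaloisRestrict K (𝔮.adicCompletion K)).continuous
  haveI : CompactSpace ↥(κ.kerSubgroup.comap (absGaloisRestrict K (𝔮.adicCompletion K)).toMonoidHom) :=
    isCompact_iff_compactSpace.mp hHFc.isCompact
  let f : ↥(κ.kerSubgroup.comap (absGaloisRestrict K (𝔮.adicCompletion K)).toMonoidHom) →* ↥(Coinv.kerD κ 𝔮) :=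
    { toFun := fun g ↦ ⟨⟨absGaloisRestrict K (𝔮.adicCompletion K) (g : absoluteGaloisGroup (𝔮.adicCompletion K)),
        (mem_decomp_iff 𝔮 _).mpr ⟨(g : absoluteGaloisGroup (𝔮.adicCompletion K)), rfl⟩⟩, (Coinv.mem_kerD_iff κ 𝔮 _).mpr g.2⟩
      map_one' := Subtype.ext (Subtype.ext (map_one (absGaloisRestrict K (𝔮.adicCompletion K))))
      map_mul' := fun a b ↦ Subtype.ext (Subtype.ext (map_mul (absGaloisRestrict K (𝔮.adicCompletion K))
        (a : absoluteGaloisGroup (𝔮.adicCompletion K)) (b : absoluteGaloisGroup (𝔮.adicCompletion K)))) }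
  have hfc : Continuous f :=
    (((absGaloisRestrict K (𝔮.adicCompletion K)).continuous.comp continuous_subtype_val).subtype_mk _).subtype_mk _
  have hfbij : Function.Bijective f := by
    constructor
    · intro a b hab
      have h := congrArg (fun y : ↥(Coinv.kerD κ 𝔮) ↦ ((y : ↥(decomp 𝔮)) : absoluteGaloisGroup K)) hab
      exact Subtype.ext (absGaloisRestrict_adicCompletion_injective K 𝔮 h)
    · rintro ⟨⟨g, hgD⟩, hgκ⟩
      obtain ⟨σ, hσ⟩ := (mem_decomp_iff 𝔮 g).mp hgD
      have hσHF : σ ∈ κ.kerSubgroup.comap (absGaloisRestrict K (𝔮.adicCompletion K)).toMonoidHom := by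
        change absGaloisRestrict K (𝔮.adicCompletion K) σ ∈ κ.kerSubgroup
        rw [hσ]; exact (Coinv.mem_kerD_iff κ 𝔮 _).mp hgκ
      exact ⟨⟨σ, hσHF⟩, Subtype.ext (Subtype.ext hσ)⟩
  let e : ↥(κ.kerSubgroup.comap (absGaloisRestrict K (𝔮.adicCompletion K)).toMonoidHom) ≃ ↥(Coinv.kerD κ 𝔮) := Equiv.ofBijective f hfbij
  have hesymm : Continuous e.symm := Continuous.continuous_symm_of_equiv_compact_to_t2 (f := e) hfc
  have hesymm_mul : ∀ a b, e.symm (a * b) = e.symm a * e.symm b := fun a b ↦ by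
    apply e.injective
    change f (e.symm (a * b)) = f (e.symm a * e.symm b)
    rw [f.map_mul]
    change e (e.symm (a * b)) = e (e.symm a) * e (e.symm b)
    simp only [Equiv.apply_symm_apply]
  -- the continuous homomorphism `g = z ∘ r ∘ e⁻¹ : D″ → M`
  let g : ↥(Coinv.kerD κ 𝔮) → M := fun y ↦
    z.1 ⟨r (((e.symm y : ↥(κ.kerSubgroup.comap (absGaloisRestrict K (𝔮.adicCompletion K)).toMonoidHom)) :
      absoluteGaloisGroup (𝔮.adicCompletion K))), hrC _⟩
  have hgmul : ∀ a b, g (a * b) = g a + g b := by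
    intro a b
    change z.1 ⟨r (((e.symm (a * b) : ↥(κ.kerSubgroup.comap (absGaloisRestrict K (𝔮.adicCompletion K)).toMonoidHom)) :
      absoluteGaloisGroup (𝔮.adicCompletion K))), hrC _⟩ = _
    rw [← hzmul]
    congr 1
    apply Subtype.ext
    change r _ = r _ * r _
    rw [← map_mul, hesymm_mul]; rfl
  have hgc : Continuous g :=
    z.1.continuous.comp ((r.continuous.comp (continuous_subtype_val.comp hesymm)).subtype_mk _)
  refine ⟨oneCocycleClass _ (homCocycle htriv g hgmul hgc), ?_, ?_⟩
  · -- the class lies in `𝓛`: `g` kills `ker κ ∩ I_𝔮` (`r` kills `I`)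
    rw [resH1Hom_toKerD_eq_zero_iff κ 𝔮 htriv, cocycleOf_oneCocycleClass]
    intro i
    obtain ⟨ι, hι, hιi⟩ := Subgroup.mem_map.mp (Subgroup.mem_inf.mp i.2).2
    have hιi' : absGaloisRestrict K (𝔮.adicCompletion K) ι = (i : absoluteGaloisGroup K) := hιi
    have hιHF : ι ∈ κ.kerSubgroup.comap (absGaloisRestrict K (𝔮.adicCompletion K)).toMonoidHom := by
      change absGaloisRestrict K (𝔮.adicCompletion K) ι ∈ κ.kerSubgroup
      rw [hιi']; exact (Subgroup.mem_inf.mp i.2).1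
    have hei : e.symm (Coinv.toKerD κ 𝔮 (kerSubgroup_inf_inertia_le_decomp κ 𝔮) inf_le_left i) = ⟨ι, hιHF⟩ := by
      apply e.injective
      rw [Equiv.apply_symm_apply]
      exact (Subtype.ext (Subtype.ext hιi')).symm
    change z.1 ⟨r (((e.symm (Coinv.toKerD κ 𝔮 (kerSubgroup_inf_inertia_le_decomp κ 𝔮) inf_le_left i) :
      ↥(κ.kerSubgroup.comap (absGaloisRestrict K (𝔮.adicCompletion K)).toMonoidHom)) : absoluteGaloisGroup (𝔮.adicCompletion K))), hrC _⟩ = 0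
    have h1 : (⟨r (((e.symm (Coinv.toKerD κ 𝔮 (kerSubgroup_inf_inertia_le_decomp κ 𝔮) inf_le_left i) :
        ↥(κ.kerSubgroup.comap (absGaloisRestrict K (𝔮.adicCompletion K)).toMonoidHom)) : absoluteGaloisGroup (𝔮.adicCompletion K))), hrC _⟩ :
        ↥((Subgroup.zpowers σ₀).topologicalClosure)) = 1 := by
      apply Subtype.ext
      rw [hei]
      exact (hrker ι).mpr hι
    rw [h1]
    exact contOneCocycles.apply_one z
  · -- the value at `φ₀`: `e⁻¹ φ₀ = σ₀`, `r σ₀ = σ₀`, `z σ₀ = m`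
    rw [evalH1_oneCocycleClass]
    have hσ₀HF : σ₀ ∈ κ.kerSubgroup.comap (absGaloisRestrict K (𝔮.adicCompletion K)).toMonoidHom := by
      change absGaloisRestrict K (𝔮.adicCompletion K) σ₀ ∈ κ.kerSubgroup
      rw [← hφ₀]; exact (Coinv.mem_kerD_iff κ 𝔮 _).mp φ₀.2
    have heφ : e.symm φ₀ = ⟨σ₀, hσ₀HF⟩ := by
      apply e.injective
      rw [Equiv.apply_symm_apply]
      exact Subtype.ext (Subtype.ext hφ₀)
    change z.1 ⟨r (((e.symm φ₀ : ↥(κ.kerSubgroup.comap (absGaloisRestrict K (𝔮.adicCompletion K)).toMonoidHom)) :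
      absoluteGaloisGroup (𝔮.adicCompletion K))), hrC _⟩ = m
    have h1 : (⟨r (((e.symm φ₀ : ↥(κ.kerSubgroup.comap (absGaloisRestrict K (𝔮.adicCompletion K)).toMonoidHom)) :
        absoluteGaloisGroup (𝔮.adicCompletion K))), hrC _⟩ : ↥((Subgroup.zpowers σ₀).topologicalClosure)) =
        ⟨σ₀, Subgroup.le_topologicalClosure _ (Subgroup.mem_zpowers σ₀)⟩ := by
      apply Subtype.ext
      rw [heφ]
      exact hrid σ₀ (Subgroup.le_topologicalClosure _ (Subgroup.mem_zpowers σ₀))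
    rw [h1, hzσ]

/-! ## §5. Equivariance under `D_𝔮` -/

/-- **`𝓛` is `D_𝔮`-stable**: for `δ ∈ D_𝔮` and `a ∈ 𝓛`, `conj_δ a ∈ 𝓛` (the cocycle of `conj_δ a` is `n ↦ δ • f_a(δ⁻¹ n δ)`, and `δ⁻¹ (ker κ ∩ I_𝔮) δ =
ker κ ∩ I_𝔮`). [cite: SerreGaloisCohomology1997, I §2.5] [cite: GreenbergVatsal2000, §2 p. 17] -/
theorem resH1Hom_toKerD_conjH1_eq_zero (htriv : ∀ (n : ↥(Coinv.kerD κ 𝔮)) (m : M), n • m = m) (δ : ↥(decomp 𝔮))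
    {a : subgroupH1 (Coinv.kerD κ 𝔮) M}
    (ha : resH1Hom (Coinv.toKerD κ 𝔮 (kerSubgroup_inf_inertia_le_decomp κ 𝔮) (inf_le_left : κ.kerSubgroup ⊓ inertia 𝔮 ≤ κ.kerSubgroup))
        (AddMonoidHom.id M) (fun _ _ ↦ rfl) a = 0) :
    resH1Hom (Coinv.toKerD κ 𝔮 (kerSubgroup_inf_inertia_le_decomp κ 𝔮) (inf_le_left : κ.kerSubgroup ⊓ inertia 𝔮 ≤ κ.kerSubgroup))
        (AddMonoidHom.id M) (fun _ _ ↦ rfl) (conjH1 (Coinv.kerD κ 𝔮) M δ a) = 0 := by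
  haveI : (absInertia (𝔮.adicCompletion K)).Normal := absInertia_normal_holds _
  rw [resH1Hom_toKerD_eq_zero_iff κ 𝔮 htriv] at ha ⊢
  intro i
  rw [cocycleOf_conjH1 _ htriv, conjCocycle_apply]
  -- `δ⁻¹ i δ ∈ ker κ ∩ I_𝔮`
  obtain ⟨γ, hγ⟩ := (mem_decomp_iff 𝔮 (δ : absoluteGaloisGroup K)).mp δ.2
  obtain ⟨ι, hι, hιi⟩ := Subgroup.mem_map.mp (Subgroup.mem_inf.mp i.2).2
  have hmem : (δ : absoluteGaloisGroup K)⁻¹ * (i : absoluteGaloisGroup K) * δ ∈ κ.kerSubgroup ⊓ inertia 𝔮 := by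
    refine Subgroup.mem_inf.mpr ⟨(inferInstance : κ.kerSubgroup.Normal).conj_mem' _ (Subgroup.mem_inf.mp i.2).1 _, ?_⟩
    refine Subgroup.mem_map.mpr ⟨γ⁻¹ * ι * γ, (absInertia_normal_holds _).conj_mem' ι hι γ, ?_⟩
    have hιi' : absGaloisRestrict K (𝔮.adicCompletion K) ι = (i : absoluteGaloisGroup K) := hιi
    change absGaloisRestrict K (𝔮.adicCompletion K) (γ⁻¹ * ι * γ) = _
    rw [map_mul, map_mul, map_inv, hγ, hιi']
  have hconj : subgroupConj (Coinv.kerD κ 𝔮) δ (Coinv.toKerD κ 𝔮 (kerSubgroup_inf_inertia_le_decomp κ 𝔮) inf_le_left i) =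
      Coinv.toKerD κ 𝔮 (kerSubgroup_inf_inertia_le_decomp κ 𝔮) inf_le_left ⟨_, hmem⟩ :=
    Subtype.ext (Subtype.ext rfl)
  rw [hconj, ha, smul_zero]

/-- **Evaluation at `φ₀` is `D_𝔮`-EQUIVARIANT on `𝓛`**: `eval_{φ₀}(conj_δ a) = δ • eval_{φ₀}(a)` for `δ ∈ D_𝔮`, `a ∈ 𝓛` — the cocycle of `conj_δ a` at `φ₀` is
`δ • f_a(δ⁻¹ φ₀ δ) = δ • (f_a(φ₀) + f_a([φ₀⁻¹, δ⁻¹]))` and the commutator lies in `ker κ ∩ I_𝔮` (`Γ_{K_𝔮} ⧸ I` is abelian, `commutator_mem_galUnr`). So `δ`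
acts on `𝓛 ≅ M` through its action on `M`. [cite: SerreGaloisCohomology1997, I §2.5] [cite: GreenbergVatsal2000, §2 pp. 17–21] -/
theorem evalH1_conjH1_eq_smul (htriv : ∀ (n : ↥(Coinv.kerD κ 𝔮)) (m : M), n • m = m)
    {σ₀ : absoluteGaloisGroup (𝔮.adicCompletion K)}
    {φ₀ : ↥(Coinv.kerD κ 𝔮)} (hφ₀ : ((φ₀ : ↥(decomp 𝔮)) : absoluteGaloisGroup K) = absGaloisRestrict K (𝔮.adicCompletion K) σ₀)
    (δ : ↥(decomp 𝔮)) {a : subgroupH1 (Coinv.kerD κ 𝔮) M}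
    (ha : resH1Hom (Coinv.toKerD κ 𝔮 (kerSubgroup_inf_inertia_le_decomp κ 𝔮) (inf_le_left : κ.kerSubgroup ⊓ inertia 𝔮 ≤ κ.kerSubgroup))
        (AddMonoidHom.id M) (fun _ _ ↦ rfl) a = 0) :
    evalH1 htriv φ₀ (conjH1 (Coinv.kerD κ 𝔮) M δ a) = (δ : absoluteGaloisGroup K) • evalH1 htriv φ₀ a := by
  haveI : (absInertia (𝔮.adicCompletion K)).Normal := absInertia_normal_holds _
  change (cocycleOf _ M htriv (conjH1 (Coinv.kerD κ 𝔮) M δ a)).1 φ₀ = (δ : absoluteGaloisGroup K) • (cocycleOf _ M htriv a).1 φ₀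
  rw [cocycleOf_conjH1 _ htriv, conjCocycle_apply]
  -- the commutator `φ₀⁻¹ δ⁻¹ φ₀ δ ∈ ker κ ∩ I_𝔮`
  obtain ⟨γ, hγ⟩ := (mem_decomp_iff 𝔮 (δ : absoluteGaloisGroup K)).mp δ.2
  have hcomm : absGaloisRestrict K (𝔮.adicCompletion K) (σ₀⁻¹ * γ⁻¹ * σ₀ * γ) ∈ κ.kerSubgroup ⊓ inertia 𝔮 := by
    have hI : σ₀⁻¹ * γ⁻¹ * σ₀ * γ ∈ absInertia (𝔮.adicCompletion K) := by
      have h := LineLocallyTrivial.commutator_mem_galUnr (K := K) (w := 𝔮) σ₀⁻¹ γ⁻¹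
      rw [inv_inv, inv_inv, galUnr_eq_absInertia] at h
      exact h
    refine Subgroup.mem_inf.mpr ⟨?_, Subgroup.mem_map.mpr ⟨_, hI, rfl⟩⟩
    -- `ker κ` part: `φ₀⁻¹ · (δ⁻¹ φ₀ δ)` with both factors in the normal subgroup `ker κ`
    have hφκ : absGaloisRestrict K (𝔮.adicCompletion K) σ₀ ∈ κ.kerSubgroup := by
      rw [← hφ₀]; exact (Coinv.mem_kerD_iff κ 𝔮 _).mp φ₀.2
    have h1 : absGaloisRestrict K (𝔮.adicCompletion K) (σ₀⁻¹ * γ⁻¹ * σ₀ * γ) =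
        (absGaloisRestrict K (𝔮.adicCompletion K) σ₀)⁻¹ *
          ((absGaloisRestrict K (𝔮.adicCompletion K) γ)⁻¹ * absGaloisRestrict K (𝔮.adicCompletion K) σ₀ *
            absGaloisRestrict K (𝔮.adicCompletion K) γ) := by
      simp only [map_mul, map_inv, mul_assoc]
    rw [h1]
    exact κ.kerSubgroup.mul_mem (κ.kerSubgroup.inv_mem hφκ) ((inferInstance : κ.kerSubgroup.Normal).conj_mem' _ hφκ _)
  have hconj : subgroupConj (Coinv.kerD κ 𝔮) δ φ₀ =
      φ₀ * Coinv.toKerD κ 𝔮 (kerSubgroup_inf_inertia_le_decomp κ 𝔮) inf_le_left ⟨_, hcomm⟩ := by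
    apply Subtype.ext; apply Subtype.ext
    change (δ : absoluteGaloisGroup K)⁻¹ * ((φ₀ : ↥(decomp 𝔮)) : absoluteGaloisGroup K) * δ =
      ((φ₀ : ↥(decomp 𝔮)) : absoluteGaloisGroup K) * absGaloisRestrict K (𝔮.adicCompletion K) (σ₀⁻¹ * γ⁻¹ * σ₀ * γ)
    rw [hφ₀, ← hγ]
    simp only [map_mul, map_inv]
    group
  have hI0 := (resH1Hom_toKerD_eq_zero_iff κ 𝔮 htriv a).mp ha ⟨_, hcomm⟩
  rw [hconj, cocycle_map_mul_of_trivial htriv, hI0, add_zero]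
  rfl

end Summit.BirchSwinnertonDyer.BirchSwinnertonDyer.Theorems.PrintCf2.LocalDefectTrivial

end
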